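import Summits.BirchSwinnertonDyer.BirchSwinnertonDyer.Theorems.SchneiderFreeAdditiveX3KrizLiHypothesisOneSemistableTwist
import HarnessLib

/-!
# Kriz–Li 2019 Thm. 1.20, hypotheses (1) AND (3) are AUTOMATIC on the WHOLE K1 door (both semistable-twist cells) at every `p ≥ 5`:
# the Kriz–Li road there needs only (2) «no split multiplicative prime» and the Bernoulli pair (4)
# (route `SchneiderFreeAdditiveX3`, Kriz–Li corner; Dirichlet side and door corollary)

Cell `bsd-schneider-ideate`, seat `bsd-schneider-door-c5` (prover, generation 37; `--supports` 19177 as helper).  PARTITION: board row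
B6 ∩ X3 ∩ sst-twist, `r = 1`, both cells at `p ≥ 5` (284 census pairs at `p = 5`, 23 at `p ∈ {7, 13}`, the `p = 37` row; class-wide) —
the KRIZ–LI SUB-LOCUS; types-the-object-of nothing new; closes none of B6's cells; BSD NOT advanced; «closes rung: none».
bears_on: K1-door (19177).

WHY / WHAT.  The siblings `…KrizLiHypothesisOneAutomatic` / `…KrizLiHypothesisOneSemistableTwist` (Galois side) show that on `W = C • V^{(p*)}`
(`V` good ordinary OR multiplicative at `p`, `p ≥ 5`) the isogeny character `r` of a rational `p`-line and its partner `r⁻¹χ̄_p` are both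
RAMIFIED at `p`.  Here:
* §1 (Dirichlet side) `invMulOmega_teichmullerLift_eq`: for `ψ = ω ∘ φ` (the Teichmüller lift of `φ : (ℤ/f)ˣ → 𝔽_pˣ`), Kriz–Li's `ψ⁻¹ω`
  (tree `invMulOmega ψ ω`, level `f·p`) IS the Teichmüller lift of `φ⁻¹ · id` (pointwise on units); `primitiveCharacter_apply_modNCyclotomicCharacter`
  (passing to the primitive character along `χ_c = χ_n mod c`); `invMulId_apply_modNCyclotomicCharacter` (`(φ⁻¹·id)(χ_{fp}(σ)) = r(σ)⁻¹χ̄_p(σ)`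
  when `φ(χ_f(σ)) = r(σ)`); hence **`dvd_conductor_invMulOmega_of_inertia_ne_cyclotomic`**: if some inertia element `τ` at `p` has
  `r(τ) ≠ χ̄_p(τ)`, then `p ∣ f(ψ⁻¹ω)` (`KrizLiThreeAutomatic.dvd_level_of_inertia_ne_one` for `r⁻¹χ̄_p` and the primitive character, with
  `IsogenyCharacterDirichlet.conductor_teichmullerLift`).
* §2 **`exists_krizLiCharacterData_h1_h3_of_subSemistableTwist`**: for `W/ℚ` globally minimal with `ClassX3 W p`, `SubSemistableTwist W p`, `p ≥ 5`: Kriz–Li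
  character data `(f, ψ, ω)` (primitive, Teichmüller, `f` supported on `p·N_W`, trace form — the construction of `IsogenyCharacterDirichlet` §5
  repeated) with **`p ∣ f`, (1) `ψ(p) ≠ 1 ∧ (ψ⁻¹ω)(p) ≠ 1`** (both values `0`) **and (3)** (`KrizLiThreeAutomatic`).  UNCONDITIONAL.
* §3 **`missingLowerBoundAt_of_printedFacts_of_thm120_of_forall_bernoulli_five_le`** — the lower half of BSD_p at ANY pair of the K1 door
  with `p ≥ 5` (`r_an(W) = 1`, `ClassX3`, semistable twist) from `PrintedFacts` + Kriz–Li Thm. 1.20 + (2) + «for every admissible character datum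
  with `p ∣ f`: an imaginary quadratic Heegner field `K` of `N_W` (odd `d_K`), its Kronecker character, and the Bernoulli pair (4)» — hypotheses
  (1) and (3) are no longer inputs (generation 36's `KrizLiLocusLValueFree.missingLowerBoundAt_of_printedFacts_of_thm120_of_heegnerField` fed
  by §2).

HONEST FRAMING: §1–§2 UNCONDITIONAL tree theorems (no definition, no named fact, no `sorry`); §3 CONDITIONAL on its displayed named facts
(`PrintedFacts`, item 19184 — thirteen published theorems; Kriz–Li 2019 Thm. 1.20, PUBLISHED) and its per-pair hypotheses (2), (4); `p = 3`
is not treated (there (1) and (3) are genuine conditions); nothing is closed; the branch cruxes r2/r3 are untouched; BSD is proved for no curve; «closes rung: none».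
References: [KrizLi2019] Thm. 1.20 (pp. 7–8), §2 (p. 11); [Serre1972] §1.11 Prop. 11; [Washington1997] Ch. 3, §5.1; [Mazur1978] §5;
this seat p744748 (`KrizLiThreeAutomatic`), p745441 (`KrizLiOneAutomatic`), the sibling `KrizLiOneSemistableTwist`, p743469 (`IsogenyCharacterDirichlet`),
p741544 (`KrizLiLocusLValueFree`).
-/

set_option autoImplicit false
-- `Summit.<P>.<Sub>` repeats `BirchSwinnertonDyer` by the tree's layout convention (D-0017)
set_option linter.dupNamespace false

noncomputable section

open scoped Classical NumberField

open NumberField IsDedekindDomain IsDedekindDomain.HeightOneSpectrum Field WeierstrassCurve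
  Literature.NumberTheory.GaloisRepresentations Literature.NumberTheory.EllipticCurves
  Literature.NumberTheory.EllipticCurves.KrizLi2019

namespace Summit.BirchSwinnertonDyer.BirchSwinnertonDyer.Theorems.SchneiderFreeAdditiveX3.KrizLiOneAutomaticDoor

/-! ### §1 Dirichlet side: `ψ⁻¹ω` is the Teichmüller lift of `φ⁻¹ · id`, and a ramified `p` divides its conductor -/

section Dirichlet

variable {p : ℕ} [hp : Fact p.Prime] {f : ℕ}

/-- **`ψ⁻¹ω` is the Teichmüller lift of `φ⁻¹ · id`.**  For `φ : (ℤ/f)ˣ → 𝔽_pˣ` and a Teichmüller-type `ω : (ℤ/p)ˣ → ℚ_pˣ`, the character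
`invMulOmega ψ ω` of level `f·p` attached to `ψ = ω ∘ φ` equals `ω ∘ (φ⁻¹ ↑ · id ↑)` (levels raised to `f·p`), as checked on units.
[cite: KrizLi2019, §2 (p. 11) and Thm. 1.20 (1), (3)] [cite: Washington1997, §5.1 (Teichmüller character)] -/
theorem invMulOmega_teichmullerLift_eq {ω : DirichletCharacter ℚ_[p] p} (φ : DirichletCharacter (ZMod p) f) :
    invMulOmega (MulChar.ofUnitHom (ω.toUnitHom.comp φ.toUnitHom) : DirichletCharacter ℚ_[p] f) ω =
      (MulChar.ofUnitHom (ω.toUnitHom.comp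
        (DirichletCharacter.changeLevel (dvd_mul_right f p) φ⁻¹ *
          DirichletCharacter.changeLevel (dvd_mul_left p f)
            (MulChar.ofUnitHom (MonoidHom.id (ZMod p)ˣ) : DirichletCharacter (ZMod p) p)).toUnitHom) :
        DirichletCharacter ℚ_[p] (f * p)) := by
  refine MulChar.ext (fun u => ?_)
  -- both sides at the unit `u` of `ℤ/(f·p)`
  set wf : (ZMod f)ˣ := ZMod.unitsMap (dvd_mul_right f p) u with hwf
  set wp : (ZMod p)ˣ := ZMod.unitsMap (dvd_mul_left p f) u with hwp
  have hcf : (ZMod.cast (u : ZMod (f * p)) : ZMod f) = (wf : ZMod f) := by rw [hwf, ZMod.unitsMap_val]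
  have hcp : (ZMod.cast (u : ZMod (f * p)) : ZMod p) = (wp : ZMod p) := by rw [hwp, ZMod.unitsMap_val]
  unfold invMulOmega
  rw [MulChar.mul_apply, DirichletCharacter.changeLevel_eq_cast_of_dvd, DirichletCharacter.changeLevel_eq_cast_of_dvd,
    hcf, hcp, MulChar.inv_apply_eq_inv', IsogenyCharacterDirichlet.teichmullerLift_coe_unit,
    IsogenyCharacterDirichlet.teichmullerLift_coe_unit, MulChar.mul_apply,
    DirichletCharacter.changeLevel_eq_cast_of_dvd, DirichletCharacter.changeLevel_eq_cast_of_dvd, hcf, hcp,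
    MulChar.inv_apply_eq_inv', MulChar.ofUnitHom_coe, MonoidHom.id_apply, map_mul]
  congr 1
  -- `(ω (φ wf))⁻¹ = ω ((φ wf)⁻¹)`
  rw [← MulChar.coe_toUnitHom φ wf, ← Units.val_inv_eq_inv_val, ← MulChar.coe_toUnitHom ω, ← MulChar.coe_toUnitHom ω,
    map_inv, Units.val_inv_eq_inv_val]

/-- **Passing to the primitive character along the cyclotomic characters.**  If `η(χ_n(σ)) = θ(σ)` for a Dirichlet character `η` mod `n`
with values in `𝔽_p`, then its primitive character `η₀` (level the conductor `c`) has `η₀(χ_c(σ)) = θ(σ)` (`χ_n mod c = χ_c`,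
`Mazur1978.unitsMap_modNCyclotomicCharacter`; `changeLevel_primitiveCharacter`). [cite: Washington1997, Ch. 3 (pp. 19–21)] -/
theorem primitiveCharacter_apply_modNCyclotomicCharacter {n : ℕ} [NeZero n] (η : DirichletCharacter (ZMod p) n)
    [NeZero η.conductor] {θ : absoluteGaloisGroup ℚ →* (ZMod p)ˣ}
    (hη : ∀ σ : absoluteGaloisGroup ℚ,
      η ((modNCyclotomicCharacter ℚ n σ : (ZMod n)ˣ) : ZMod n) = ((θ σ : (ZMod p)ˣ) : ZMod p))
    (σ : absoluteGaloisGroup ℚ) :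
    η.primitiveCharacter ((modNCyclotomicCharacter ℚ η.conductor σ : (ZMod η.conductor)ˣ) : ZMod η.conductor) =
      ((θ σ : (ZMod p)ˣ) : ZMod p) := by
  have h := η.primitiveCharacter.changeLevel_toUnitHom η.conductor_dvd_level
  rw [DirichletCharacter.changeLevel_primitiveCharacter] at h
  calc η.primitiveCharacter ((modNCyclotomicCharacter ℚ η.conductor σ : (ZMod η.conductor)ˣ) : ZMod η.conductor)
      = ((η.primitiveCharacter.toUnitHom (modNCyclotomicCharacter ℚ η.conductor σ) : (ZMod p)ˣ) : ZMod p) :=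
        (MulChar.coe_toUnitHom _ _).symm
    _ = ((η.primitiveCharacter.toUnitHom (ZMod.unitsMap η.conductor_dvd_level (modNCyclotomicCharacter ℚ n σ)) :
          (ZMod p)ˣ) : ZMod p) := by
        rw [Mazur1978.unitsMap_modNCyclotomicCharacter η.conductor_dvd_level σ]
    _ = ((η.toUnitHom (modNCyclotomicCharacter ℚ n σ) : (ZMod p)ˣ) : ZMod p) := by rw [h]; rfl
    _ = η ((modNCyclotomicCharacter ℚ n σ : (ZMod n)ˣ) : ZMod n) := MulChar.coe_toUnitHom _ _
    _ = ((θ σ : (ZMod p)ˣ) : ZMod p) := hη σ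

/-- **`(φ⁻¹·id)(χ_{fp}(σ)) = r(σ)⁻¹ · χ̄_p(σ)`** when `φ(χ_f(σ)) = r(σ)`: the Galois character cut out by the level-`f·p` Dirichlet character
`φ⁻¹ · id` is `r⁻¹ · χ̄_p`. [cite: Washington1997, Ch. 3] [cite: Mazur1978, §5 (p. 148)] -/
theorem invMulId_apply_modNCyclotomicCharacter [NeZero f] {r : absoluteGaloisGroup ℚ →* (ZMod p)ˣ}
    {φ : DirichletCharacter (ZMod p) f}
    (hφ : ∀ σ : absoluteGaloisGroup ℚ,
      φ ((modNCyclotomicCharacter ℚ f σ : (ZMod f)ˣ) : ZMod f) = ((r σ : (ZMod p)ˣ) : ZMod p))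
    (σ : absoluteGaloisGroup ℚ) :
    haveI : NeZero (f * p) := ⟨mul_ne_zero (NeZero.ne f) hp.out.ne_zero⟩
    (DirichletCharacter.changeLevel (dvd_mul_right f p) φ⁻¹ *
        DirichletCharacter.changeLevel (dvd_mul_left p f) (MulChar.ofUnitHom (MonoidHom.id (ZMod p)ˣ)))
      ((modNCyclotomicCharacter ℚ (f * p) σ : (ZMod (f * p))ˣ) : ZMod (f * p)) =
      (((r⁻¹ * modNCyclotomicCharacter ℚ p) σ : (ZMod p)ˣ) : ZMod p) := by
  haveI : NeZero (f * p) := ⟨mul_ne_zero (NeZero.ne f) hp.out.ne_zero⟩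
  have hcf : (ZMod.cast ((modNCyclotomicCharacter ℚ (f * p) σ : (ZMod (f * p))ˣ) : ZMod (f * p)) : ZMod f) =
      ((modNCyclotomicCharacter ℚ f σ : (ZMod f)ˣ) : ZMod f) := by
    rw [← Mazur1978.unitsMap_modNCyclotomicCharacter (dvd_mul_right f p) σ, ZMod.unitsMap_val]
  have hcp : (ZMod.cast ((modNCyclotomicCharacter ℚ (f * p) σ : (ZMod (f * p))ˣ) : ZMod (f * p)) : ZMod p) =
      ((modNCyclotomicCharacter ℚ p σ : (ZMod p)ˣ) : ZMod p) := by
    rw [← Mazur1978.unitsMap_modNCyclotomicCharacter (dvd_mul_left p f) σ, ZMod.unitsMap_val]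
  rw [MulChar.mul_apply, DirichletCharacter.changeLevel_eq_cast_of_dvd, DirichletCharacter.changeLevel_eq_cast_of_dvd,
    hcf, hcp, MulChar.inv_apply_eq_inv', MulChar.ofUnitHom_coe, MonoidHom.id_apply,
    hφ σ, MonoidHom.mul_apply, MonoidHom.inv_apply, Units.val_mul, Units.val_inv_eq_inv_val]

/-- **`p ∣ f(ψ⁻¹ω)` when `r⁻¹χ̄_p` is ramified at `p`.**  For `ψ = ω ∘ φ` the Teichmüller lift of `φ` with `φ(χ_f(σ)) = r(σ)`, and an element
`τ` of the inertia group of a prime `𝔓` of `\bar ℤ` above `p` with `r(τ) ≠ χ̄_p(τ)`: the conductor of `invMulOmega ψ ω` (hence of the primitive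
character inducing `ψ⁻¹ω`) is divisible by `p` — §1's identities, `IsogenyCharacterDirichlet.conductor_teichmullerLift`, and
`KrizLiThreeAutomatic.dvd_level_of_inertia_ne_one` applied to `r⁻¹χ̄_p` and the primitive character.
[cite: KrizLi2019, Thm. 1.20 hypothesis (1) (p. 7)] [cite: Washington1997, Prop. 2.3 and Ch. 3] -/
theorem dvd_conductor_invMulOmega_of_inertia_ne_cyclotomic [NeZero f] {ω : DirichletCharacter ℚ_[p] p}
    (hω : IsTeichmullerCharacter ω) {r : absoluteGaloisGroup ℚ →* (ZMod p)ˣ} {φ : DirichletCharacter (ZMod p) f}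
    (hφ : ∀ σ : absoluteGaloisGroup ℚ,
      φ ((modNCyclotomicCharacter ℚ f σ : (ZMod f)ˣ) : ZMod f) = ((r σ : (ZMod p)ˣ) : ZMod p))
    {v : HeightOneSpectrum (𝓞 ℚ)} (hv : Rat.HeightOneSpectrum.natGenerator v = p)
    {𝔓 : Ideal (absIntegers (𝓞 ℚ) ℚ)} (h𝔓 : 𝔓 ∈ v.primesAbove)
    {τ : absoluteGaloisGroup ℚ} (hτ : τ ∈ 𝔓.inertia (absoluteGaloisGroup ℚ))
    (hne : ((r τ : (ZMod p)ˣ) : ZMod p) ≠ ((modNCyclotomicCharacter ℚ p τ : (ZMod p)ˣ) : ZMod p)) :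
    p ∣ (invMulOmega (MulChar.ofUnitHom (ω.toUnitHom.comp φ.toUnitHom) : DirichletCharacter ℚ_[p] f) ω).conductor := by
  haveI : NeZero (f * p) := ⟨mul_ne_zero (NeZero.ne f) hp.out.ne_zero⟩
  set φ' : DirichletCharacter (ZMod p) (f * p) :=
    DirichletCharacter.changeLevel (dvd_mul_right f p) φ⁻¹ *
      DirichletCharacter.changeLevel (dvd_mul_left p f) (MulChar.ofUnitHom (MonoidHom.id (ZMod p)ˣ)) with hφ'def
  haveI : NeZero φ'.conductor := ⟨φ'.conductor_ne_zero⟩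
  have hc : (invMulOmega (MulChar.ofUnitHom (ω.toUnitHom.comp φ.toUnitHom) : DirichletCharacter ℚ_[p] f) ω).conductor =
      φ'.conductor := by
    rw [invMulOmega_teichmullerLift_eq]; exact IsogenyCharacterDirichlet.conductor_teichmullerLift hω φ'
  rw [hc]
  refine KrizLiThreeAutomatic.dvd_level_of_inertia_ne_one (r := r⁻¹ * modNCyclotomicCharacter ℚ p)
    (φ := φ'.primitiveCharacter)
    (fun σ => primitiveCharacter_apply_modNCyclotomicCharacter φ' (fun σ' => invMulId_apply_modNCyclotomicCharacter hφ σ') σ)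
    hv h𝔓 hτ ?_
  intro h1
  apply hne
  rw [MonoidHom.mul_apply, MonoidHom.inv_apply, inv_mul_eq_one] at h1
  rw [h1]

end Dirichlet

/-! ### §2 On the K1 door at `p ≥ 5` (both semistable-twist cells): Kriz–Li's character data WITH hypotheses (1) and (3) -/

/-- `(ψ₁ψ₂)(ℓ) = 0` for a prime `ℓ` dividing the conductor of the primitive character (Kriz–Li's convention, tree `primVal`).
[cite: KrizLi2019, §2 (p. 11, conventions on primitive characters)] -/
theorem primVal_eq_zero_of_dvd_conductor {p : ℕ} [Fact p.Prime] {n : ℕ} (χ : DirichletCharacter ℚ_[p] n)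
    {ℓ : ℕ} (hℓ : ℓ.Prime) (hdvd : ℓ ∣ χ.conductor) : primVal χ ℓ = 0 := by
  unfold primVal
  refine MulChar.map_nonunit _ (fun hu => ?_)
  rw [ZMod.isUnit_iff_coprime] at hu
  have h1 : ℓ ∣ Nat.gcd ℓ χ.conductor := Nat.dvd_gcd (dvd_refl ℓ) hdvd
  rw [hu] at h1
  exact hℓ.one_lt.ne' (Nat.dvd_one.mp h1)

open Summit.BirchSwinnertonDyer.Rank1Residual Literature.NumberTheory.EllipticCurves.Rank1Residual in
/-- **On the K1 door at `p ≥ 5` (both semistable-twist cells), Kriz–Li's character data exist WITH hypotheses (1) and (3).**  For `W/ℚ`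
globally minimal with `ClassX3 W p` and `SubSemistableTwist W p` (`W = C • V^{(p*)}`, `V` multiplicative or good ordinary at `p`), `p ≥ 5`: there
are `f ≥ 1` supported on `p·N_W`, a PRIMITIVE `ψ : (ℤ/f)ˣ → ℚ_pˣ` (the Teichmüller lift of the isogeny character `r = φ ∘ χ_f` of a rational
`p`-line `⟨T⟩ ≤ W[p]`) and a Teichmüller `ω` with the trace form at every `ℓ ∤ p·N_W`, such that **`p ∣ f`, `ψ(p) ≠ 1`, `(ψ⁻¹ω)(p) ≠ 1`** (the
sibling's two inertia witnesses at `p`: `r` ramified gives `p ∣ f`, `r⁻¹χ̄_p` ramified gives `p ∣ f(ψ⁻¹ω)`; both values vanish) **and (3)** at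
every additive `ℓ ≠ p` (`KrizLiThreeAutomatic`).  UNCONDITIONAL. [cite: KrizLi2019, Thm. 1.20 (pp. 7–8) hypotheses (1), (3)]
[cite: Serre1972, §1.11 Prop. 11, §1.12 Prop. 13] [cite: Mazur1978, §5 (p. 148) and Prop. 6.3 (1) (p. 153)] [cite: SilvermanAEC2009, X.5 Cor. 5.4, Thm. VII.6.1] -/
theorem exists_krizLiCharacterData_h1_h3_of_subSemistableTwist (W : WeierstrassCurve ℚ) [W.IsElliptic] [W.IsGloballyMinimal]
    (p : ℕ) [hp : Fact p.Prime] (h5 : 5 ≤ p) (hX : ClassX3 W p) (hS : Additive.SubSemistableTwist W p) :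
    ∃ (f : ℕ) (_ : NeZero f) (ψ : DirichletCharacter ℚ_[p] f) (ω : DirichletCharacter ℚ_[p] p),
      ψ.IsPrimitive ∧ IsTeichmullerCharacter ω ∧ (∀ q : ℕ, q.Prime → q ∣ f → q ∣ p * W.conductorNorm ℤ) ∧
      (∀ ℓ : ℕ, ℓ.Prime → ¬ (ℓ ∣ p * W.conductorNorm ℤ) →
        ‖((W.LFunction ℓ : ℤ) : ℚ_[p]) - (ψ (ℓ : ZMod f) + ψ⁻¹ (ℓ : ZMod f) * ω (ℓ : ZMod p))‖ < 1) ∧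
      -- hypothesis (1): `p ∣ f`, `ψ(p) ≠ 1`, `(ψ⁻¹ω)(p) ≠ 1`
      p ∣ f ∧ (ψ (p : ZMod f) ≠ 1 ∧ primVal (invMulOmega ψ ω) p ≠ 1) ∧
      -- hypothesis (3)
      (∀ ℓ : ℕ, (hℓ : ℓ.Prime) → ℓ ≠ p →
        (haveI := Fact.mk hℓ; ¬ W.HasGoodReductionAtPrime ℓ ∧ ¬ W.HasMultiplicativeReductionAtPrime ℓ) →
        ψ (ℓ : ZMod f) ≠ 1 ∧ primVal (invMulOmega ψ ω) ℓ ≠ 1) := by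
  have hpP : p.Prime := hp.out
  have hred : ¬ W.HasIrreducibleModPGaloisRep p := hX.1
  -- a stable line `⟨T⟩` and its isogeny character `r` (as in `IsogenyCharacterDirichlet` §5)
  obtain ⟨H, hH, hcard⟩ := (Mazur1978.not_hasIrreducibleModPGaloisRep_iff_exists_natCard_eq W p).mp hred
  obtain ⟨T, hT0, rfl⟩ := Mazur1978.exists_eq_zmultiples_of_natCard_eq W p hcard
  have hst : ∀ σ : absoluteGaloisGroup ℚ, σ • T ∈ AddSubgroup.zmultiples T :=
    fun σ => hH σ T (AddSubgroup.mem_zmultiples T)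
  obtain ⟨r, hr⟩ := Mazur1978.exists_isogenyCharacter W p hT0 hst
  have hker := Mazur1978.isOpen_ker_of_smul_eq W p hT0 hr
  -- good reduction off `p·N_W`
  have hgood : ∀ (q : ℕ) [Fact q.Prime], ¬ q ∣ p * W.conductorNorm ℤ → W.HasGoodReductionAtPrime q := by
    intro q _ hqnd
    by_contra hng
    exact hqnd (dvd_mul_of_dvd_right ((W.dvd_conductorNorm_iff_not_hasGoodReductionAtPrime q).mpr hng) p)
  -- `r` is unramified outside `S` = the bad primes and `p`
  set S : Set ℕ := {q | q.Prime ∧ q ∣ p * W.conductorNorm ℤ} with hSdef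
  have hunr : ∀ q : ℕ, q.Prime → q ∉ S → ∀ (v : HeightOneSpectrum (𝓞 ℚ)), Rat.HeightOneSpectrum.natGenerator v = q →
      ∀ 𝔓 ∈ v.primesAbove, ∀ τ ∈ 𝔓.inertia (absoluteGaloisGroup ℚ), r τ = 1 := by
    intro q hq hqS v hgen 𝔓 h𝔓 τ hτ
    have hqnd : ¬ q ∣ p * W.conductorNorm ℤ := fun h => hqS ⟨hq, h⟩
    have hgoodv : W.HasGoodReductionAt v := by
      haveI hF := Fact.mk (Rat.HeightOneSpectrum.primesEquiv v).2
      refine (hasGoodReductionAtPrime_iff_hasGoodReductionAt_ringOfIntegers v W).mp (hgood _ ?_)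
      have hq' : ((Rat.HeightOneSpectrum.primesEquiv v : Nat.Primes) : ℕ) = q := hgen
      rw [hq']
      exact hqnd
    have hpv : ((p : ℕ) : 𝓞 ℚ) ∉ v.asIdeal := by
      intro hmem
      have h1 : ((Rat.HeightOneSpectrum.primesEquiv v : Nat.Primes) : ℕ) = p := primesEquiv_eq_of_natCast_mem hpP hmem
      have h2 : ((Rat.HeightOneSpectrum.primesEquiv v : Nat.Primes) : ℕ) = q := hgen
      exact hqnd (by rw [← h2, h1]; exact dvd_mul_right p _)
    exact Mazur1978.isogenyCharacter_eq_one_of_mem_inertia W p hT0 hr hgoodv hpv h𝔓 hτ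
  -- `r = φ ∘ χ_f`, `φ` primitive, `f` supported on `S`
  obtain ⟨f, hf, φ, hφprim, hfS, hφ⟩ := IsogenyCharacterDirichlet.exists_isPrimitive_zmod_of_character p r hker S hunr
  -- (3): every additive prime `ℓ ≠ p` divides `f` (`KrizLiThreeAutomatic` §2–§3)
  have hdvd : ∀ ℓ : ℕ, (hℓ : ℓ.Prime) → ℓ ≠ p →
      (haveI := Fact.mk hℓ; ¬ W.HasGoodReductionAtPrime ℓ ∧ ¬ W.HasMultiplicativeReductionAtPrime ℓ) → ℓ ∣ f := by
    intro ℓ hℓ hℓp hadd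
    obtain ⟨v, hv, 𝔓, h𝔓, τ, hτ, hrτ⟩ :=
      KrizLiThreeAutomatic.exists_mem_inertia_isogenyCharacter_ne_one W p h5 hT0 hr hℓ hℓp hadd.1 hadd.2
    exact KrizLiThreeAutomatic.dvd_level_of_inertia_ne_one hφ hv h𝔓 hτ hrτ
  -- (1): the two inertia witnesses at `p` on the semistable-twist cells (sibling `…KrizLiHypothesisOneSemistableTwist`)
  obtain ⟨v, hv, 𝔓, h𝔓, ⟨τa, hτa, hra⟩, ⟨τb, hτb, hrb⟩⟩ :=
    KrizLiOneSemistableTwist.exists_inertia_witnesses_of_classX3_of_subSemistableTwist W h5 hX hS hT0 hr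
  have hpf : p ∣ f := KrizLiThreeAutomatic.dvd_level_of_inertia_ne_one hφ hv h𝔓 hτa hra
  -- the Teichmüller lift `ψ = ω ∘ φ`
  obtain ⟨ω, hω⟩ := KrizLi2019.exists_isTeichmullerCharacter (p := p)
  have hψprim := IsogenyCharacterDirichlet.isPrimitive_teichmullerLift hω hφprim
  have hcond : p ∣ (invMulOmega (MulChar.ofUnitHom (ω.toUnitHom.comp φ.toUnitHom) : DirichletCharacter ℚ_[p] f) ω).conductor :=
    dvd_conductor_invMulOmega_of_inertia_ne_cyclotomic hω hφ hv h𝔓 hτb hrb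
  refine ⟨f, hf, MulChar.ofUnitHom (ω.toUnitHom.comp φ.toUnitHom), ω, hψprim, hω,
    fun q hq hqf => (hfS q hq hqf).2, ?_, hpf, ⟨?_, ?_⟩, fun ℓ hℓ hℓp hadd => ?_⟩
  · -- the trace form at a prime `ℓ ∤ p·N_W` (verbatim `IsogenyCharacterDirichlet` §5)
    intro ℓ hℓ hℓpN
    haveI := Fact.mk hℓ
    have hℓp : ℓ ≠ p := fun h => hℓpN (by rw [h]; exact dvd_mul_right p _)
    have hpℓ : ¬ p ∣ ℓ := fun h => hℓp ((Nat.prime_dvd_prime_iff_eq hpP hℓ).mp h).symm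
    have hgoodℓ : W.HasGoodReductionAtPrime ℓ := hgood ℓ hℓpN
    have hℓf : ¬ ℓ ∣ f := fun h => hℓpN (hfS ℓ hℓ h).2
    set v : HeightOneSpectrum (𝓞 ℚ) := Rat.HeightOneSpectrum.primesEquiv.symm ⟨ℓ, hℓ⟩ with hvdef
    have hgen : Rat.HeightOneSpectrum.natGenerator v = ℓ := by
      change ((Rat.HeightOneSpectrum.primesEquiv v : Nat.Primes) : ℕ) = ℓ
      rw [hvdef, Equiv.apply_symm_apply]
    have hvℓ : ((ℓ : ℕ) : 𝓞 ℚ) ∈ v.asIdeal := by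
      have h := Mazur1978.natCast_natGenerator_mem_asIdeal v
      rwa [hgen] at h
    obtain ⟨𝔓, h𝔓⟩ := HeightOneSpectrum.primesAbove_nonempty v
    obtain ⟨φF, hφF⟩ := exists_isArithFrobAt_of_mem_primesAbove_holds (K := ℚ) (v := v) h𝔓
    have htrace := Mazur1978.isogenyCharacter_add_div_eq_frobeniusTrace W p ℓ hℓp hgoodℓ hT0 hr hvℓ h𝔓 hφF
    have hχ : ((modNCyclotomicCharacter ℚ f φF : (ZMod f)ˣ) : ZMod f) = (ℓ : ℕ) :=
      Literature.NumberTheory.GaloisRepresentations.Rat.modNCyclotomicCharacter_of_isArithFrobAt hℓ hℓf hvℓ h𝔓 hφF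
    have hcop : Nat.Coprime ℓ f := (Nat.Prime.coprime_iff_not_dvd hℓ).mpr hℓf
    set xu : (ZMod f)ˣ := ZMod.unitOfCoprime ℓ hcop with hxudef
    have hxu : (xu : ZMod f) = (ℓ : ZMod f) := ZMod.coe_unitOfCoprime ℓ hcop
    set u : (ZMod p)ˣ := r φF with hudef
    have hφℓ : φ (ℓ : ZMod f) = (u : ZMod p) := by rw [← hχ, hφ φF]
    have hψℓ : (MulChar.ofUnitHom (ω.toUnitHom.comp φ.toUnitHom) : DirichletCharacter ℚ_[p] f) (ℓ : ZMod f) =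
        ω (u : ZMod p) := by
      rw [← hxu, IsogenyCharacterDirichlet.teichmullerLift_coe_unit, hxu, hφℓ]
    have hψℓ' : (MulChar.ofUnitHom (ω.toUnitHom.comp φ.toUnitHom) : DirichletCharacter ℚ_[p] f)⁻¹ (ℓ : ZMod f) =
        (ω (u : ZMod p))⁻¹ := by
      rw [MulChar.inv_apply_eq_inv', hψℓ]
    rw [hψℓ, hψℓ', LFunction_apply_prime_eq_frobeniusTrace W ℓ hgoodℓ]
    exact IsogenyCharacterDirichlet.norm_sub_lt_one_of_trace_congr hω u hpℓ (W.frobeniusTrace ℓ) htrace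
  · -- (1a): `ψ(p) = 0`
    rw [KrizLiThreeAutomatic.apply_natCast_eq_zero_of_dvd_level _ hpP hpf]; exact zero_ne_one
  · -- (1b): `(ψ⁻¹ω)(p) = 0`
    rw [primVal_eq_zero_of_dvd_conductor _ hpP hcond]; exact zero_ne_one
  · -- (3)
    have hℓf := hdvd ℓ hℓ hℓp hadd
    refine ⟨?_, ?_⟩
    · rw [KrizLiThreeAutomatic.apply_natCast_eq_zero_of_dvd_level _ hℓ hℓf]; exact zero_ne_one
    · rw [KrizLiThreeAutomatic.primVal_invMulOmega_eq_zero_of_dvd_level hψprim ω hℓ hℓf hℓp]; exact zero_ne_one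

/-! ### §3 The Kriz–Li road on the K1 door at `p ≥ 5`: only (2) and the Bernoulli pair remain -/

open Summit.BirchSwinnertonDyer.Rank1Residual Literature.NumberTheory.EllipticCurves.Rank1Residual
  Literature.NumberTheory.EllipticCurves.Rank1Residual.Typed
  Summit.BirchSwinnertonDyer.BirchSwinnertonDyer.Theses.SchneiderFreeAdditiveX3 in
/-- **The Kriz–Li road on the K1 door at `p ≥ 5` WITHOUT hypotheses (1) and (3).**  For `W/ℚ` globally minimal with `r_an(W) = 1`,
`ClassX3 W p`, `SubSemistableTwist W p`, `p ≥ 5`, and (2) no prime of split multiplicative reduction: if for EVERY admissible character datum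
`(f, ψ, ω)` (primitive `ψ`, Teichmüller `ω`, `f` supported on `p·N_W`, trace form, `p ∣ f` — such data exist, §2) there are an imaginary quadratic
Heegner field `K` of `N_W` with odd `d_K`, its Kronecker character `ε_K`, and the Bernoulli pair (4) `B_{1,ψ₀⁻¹ε_K}·B_{1,ψ₀ω⁻¹} ≢ 0 (mod p)`, then
`MissingLowerBoundAt W p` — the lower half of BSD_p at `W` — by §2 and generation 36's
`KrizLiLocusLValueFree.missingLowerBoundAt_of_printedFacts_of_thm120_of_heegnerField`.  CONDITIONAL on `hF` (`PrintedFacts`) and `hKL`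
(Kriz–Li Thm. 1.20, published); closes nothing by name; BSD is NOT advanced.
[cite: KrizLi2019, Thm. 1.20 (pp. 7–8)] [cite: GrossZagier1986, Thm. I.(6.3)] [cite: JetchevSkinnerWan2017, §7.4.1 (arXiv:1512.06894 p. 30)] -/
theorem missingLowerBoundAt_of_printedFacts_of_thm120_of_forall_bernoulli_five_le (hF : PrintedFacts)
    (hKL : KrizLi2019.thm120_padicLogHeegner_unit_of_bernoulli)
    (W : WeierstrassCurve ℚ) [W.IsElliptic] [W.IsGloballyMinimal] (p : ℕ) [Fact p.Prime]
    (hr : W.analyticRank = 1) (h5 : 5 ≤ p) (hX : ClassX3 W p) (hS : Additive.SubSemistableTwist W p)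
    -- (2) no prime of split multiplicative reduction
    (h2 : ∀ ℓ : ℕ, (hℓ : ℓ.Prime) → ¬ (haveI := Fact.mk hℓ; W.HasSplitMultiplicativeReductionAtPrime ℓ))
    -- for every admissible character datum: a Heegner field (odd `d_K`) with the Bernoulli pair (4)
    (hdat : ∀ (f : ℕ) [NeZero f] (ψ : DirichletCharacter ℚ_[p] f) (ω : DirichletCharacter ℚ_[p] p),
      ψ.IsPrimitive → IsTeichmullerCharacter ω → (∀ q : ℕ, q.Prime → q ∣ f → q ∣ p * W.conductorNorm ℤ) →
      (∀ ℓ : ℕ, ℓ.Prime → ¬ (ℓ ∣ p * W.conductorNorm ℤ) →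
        ‖((W.LFunction ℓ : ℤ) : ℚ_[p]) - (ψ (ℓ : ZMod f) + ψ⁻¹ (ℓ : ZMod f) * ω (ℓ : ZMod p))‖ < 1) →
      p ∣ f →
      ∃ (K : Type) (_ : Field K) (_ : NumberField K) (εK : DirichletCharacter ℚ_[p] (NumberField.discr K).natAbs),
        IsImaginaryQuadratic K ∧ Odd (NumberField.discr K) ∧ SatisfiesHeegnerHypothesis (W.conductorNorm ℤ) K ∧
        IsKroneckerCharacterOf K εK ∧
        ¬ (‖bernoulliOnePrim (bernoulliCharOne ψ εK) * bernoulliOnePrim (bernoulliCharTwo ψ εK ω)‖ ≤ (p : ℝ)⁻¹)) :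
    MissingLowerBoundAt W p := by
  have hp2 : p ≠ 2 := by omega
  obtain ⟨f, hf, ψ, ω, hψ, hω, hfN, hss, hpf, ⟨h1, h1'⟩, h3⟩ := exists_krizLiCharacterData_h1_h3_of_subSemistableTwist W p h5 hX hS
  obtain ⟨K, _, _, εK, hK, hodd, hHe, hεK, h4⟩ := hdat f ψ ω hψ hω hfN hss hpf
  exact KrizLiLocusLValueFree.missingLowerBoundAt_of_printedFacts_of_thm120_of_heegnerField hF hKL W p hr hp2 hX hS
    f ψ ω hψ hω hss h1 h1' h2 h3 K hK hodd hHe εK hεK h4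

end Summit.BirchSwinnertonDyer.BirchSwinnertonDyer.Theorems.SchneiderFreeAdditiveX3.KrizLiOneAutomaticDoor

end
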